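/-
Copyright (c) 2026 the pub-hodgecm-mathlib formalisation cell (harness21).  Prover seat hodgecm-mathlib-K2Liu-p08 (g6), Track B «K2-LIT»,
#184♮ = hLiu418 = `stmt-HodgeConjecture-24832`; #42S BLOCK D, row D-2, (σ-A) mini-road (LEAD F0P6-plan (g15) RULING M-160f ∕ BATCH #238; (σ-A) road desk
K2Liu-p25 (g3) WORDs #29, #32), brick (an-3c-int): THE `L¹` LETTER (I2) of ★ p864562 `coneWord_of_stageLetters` from primitive letters.
THEOREMS ONLY (no `def`, no `instance`, no `notation`, no named-fact hypothesis, no `sorry`, default heartbeats).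
-/
import Summits.HodgeConjecture.HodgeConjecture.Theorems.K2LiuConeVertexFubini                     -- ★ p864503 (an-3b): fibre mass of a box, vertex summation, Tonelli assembly
import Literature.RepresentationTheory.HeisenbergGroup.SchrodingerConjugateTorusSphericalCoeff    -- ★ `measureReal_piPrimePowBall_pi_eq_zpow_mul` (box scaling for the product Haar measure)
import HarnessLib

/-!
# Crux `HLiu418`, #42S BLOCK D, row D-2, (σ-A) brick (an-3c-int): THE DENSITY OF THE CONE WORD IS `L¹` ON `σ ⊗ μ^{ι₂}` (letter (I2))

Cell `hodgecm-mathlib`, crux item hLiu418 = `stmt-HodgeConjecture-24832` (helper lane `--supports … --as helper`, count-neutral; closes no socket); squad K2 ∕ K2Liu (L1).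
Prover K2Liu-p08 (g6) = pen of [A4]∕(an-3) under the (σ-A) road desk K2Liu-p25 (g3).

THE POINT.  ★ p864562 (an-3c) CORE `coneWord_of_stageLetters` takes two `L¹` letters BY VALUE; THIS FILE pays the product one, (I2):
  `Integrable (fun (s,b) => |det A_s| · Θ(A_s(0 ⊔ b) ⊔ s)) (σ ⊗ μ^{ι₂})`
for `Θ ∈ 𝒮(F^ι)`, a measurable family of frames `A_s` ADAPTED to the graph maps `Z_s` off the vertex (★ p864435 (an-3a) ∕ (an-3c-charts) K2Liu-p12) whose fibre
coordinate stays in the box (`A_s(0 ⊔ b) ∈ (𝔭^N)^{ι₁} → b ∈ (𝔭^N)^{ι₂}`, (an-3c-charts) FLAG 3), the LOWER-BOUND letter of (an-3c-charts) (iii) in ★ p864503 §2's bytes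
(`Z_s ζ ∈ (𝔭^N)^{ι₁} → ζ ∈ (𝔭^{N − level s − c₀})^κ`), and (an-1)'s null-cone measure letters (LH4-p07 `exists_nullConeMeasure`: finite on compacts, `σ{0} = 0`,
VERTEX LAW `σ((𝔭^{n+1})^{ι₁′}) = c·σ((𝔭^n)^{ι₁′})` with `c = q^{−card ι₁′}·q²`), under the numerology `card κ + 2 < card ι₁′` (`2 + 2 < 6` at the record).
* §1 `measureReal_pi_piPrimePowBall_sub_natCast` (`μ^κ((𝔭^{n−k})^κ) = (q^{card κ})^k·μ^κ((𝔭^n)^κ)`), `measure_piPrimePowBall_le_of_vertexLaw` (the law as the shell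
  letter of ★ p864503 §3: `σ((𝔭^{N₀+k})^{ι₁′}) ≤ σ((𝔭^{N₀})^{ι₁′})·c^k`);
* §2 slice support and the fibre bound at `s ≠ 0` (★ p864503 §2 `fibreMass_box_le` in `ℝ≥0∞`);
* §3 **`integrable_frameDensity`** = (I2) (★ p864503 §3 `setLIntegral_lt_top_of_shell_bound` with `r = q^{card κ}`, `ρ = c`, `r·ρ = q^{card κ+2−card ι₁′} < 1`, + §4
  `integrable_prod_of_lintegral_fibre_le`).
[Weil1965, Chap. III n° 37 Prop. 6] [WeilBNT1967, Chap. VII §2 Cor. 1; Chap. II §2 Prop. 4] [KudlaRallis1994, §2 (2.10)–(2.12)].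
HONEST LABEL.  Count-neutral helper; the frames, the lower-bound letter and (an-1)'s clauses enter BY VALUE; `HC_CM` is proved only modulo the 7 printed citations
(2 remaining named inputs: hLiu418 = `stmt-HodgeConjecture-24832`, h413 = `stmt-HodgeConjecture-24833`) until rung 0 closes.  NOT here: (I1) (the `ζ ↔ s` letter, sibling file).

## References
* [Weil1965] A. Weil, *Sur la formule de Siegel dans la théorie des groupes classiques*, Acta Math. 113 (1965), Chap. III n° 37 Prop. 6.
* [WeilBNT1967] A. Weil, *Basic Number Theory* (1967), Chap. II §2 Prop. 4 (module of boxes), Chap. VII §2 Cor. 1.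
* [KudlaRallis1994] S. Kudla, S. Rallis, *A regularized Siegel–Weil formula: the first term identity*, Ann. of Math. 140 (1994), §2 (2.10)–(2.12).
-/

set_option autoImplicit false
set_option linter.dupNamespace false -- the mandated namespace repeats `HodgeConjecture.HodgeConjecture`

noncomputable section

open MeasureTheory Set Filter Function
open scoped Matrix NNReal ENNReal
open Literature.NumberTheory.Automorphic
open Literature.NumberTheory.GaloisRepresentations Literature.NumberTheory.GaloisRepresentations.IsNonarchimedeanLocalField
open Literature.RepresentationTheory.HeisenbergGroup
open Literature.NumberTheory.Weil1965.SplitPlace (level mem_shell_level le_level_of_mem level_eq_of_mem_shell)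
open Summit.HodgeConjecture.HodgeConjecture.Cruxes.HLiu418
open Summit.HodgeConjecture.HodgeConjecture.Cruxes.HLiu418.K2LiuConeVertexFubini

namespace Summit.HodgeConjecture.HodgeConjecture.Cruxes.HLiu418.K2LiuConeWordIntegrability

variable {F : Type*} [Field F] [ValuativeRel F] [TopologicalSpace F] [IsNonarchimedeanLocalField F]
  [MeasurableSpace F] [BorelSpace F] (μ : Measure F) [μ.IsAddHaarMeasure]

/-! ## §1 Box scaling and the vertex law as a shell letter -/

section Scaling

variable {κ : Type*} [Fintype κ]

/-- **`μ^κ((𝔭^{n−k})^κ) = (q^{card κ})^k · μ^κ((𝔭^n)^κ)`** (★ `measureReal_piPrimePowBall_pi_eq_zpow_mul`). [cite: WeilBNT1967, Chap. II §2, Prop. 4] -/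
theorem measureReal_pi_piPrimePowBall_sub_natCast (n : ℤ) (k : ℕ) :
    (Measure.pi fun _ : κ => μ).real (piPrimePowBall F κ (n - k)) =
      ((residueFieldCard F : ℝ) ^ Fintype.card κ) ^ k * (Measure.pi fun _ : κ => μ).real (piPrimePowBall F κ n) := by
  have hq : ((residueFieldCard F : ℝ) ^ Fintype.card κ) ≠ 0 := pow_ne_zero _ (Nat.cast_ne_zero.2 (residueFieldCard_ne_zero F))
  rw [measureReal_piPrimePowBall_pi_eq_zpow_mul μ (n - k), measureReal_piPrimePowBall_pi_eq_zpow_mul μ n, ← mul_assoc]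
  congr 1
  rw [zpow_sub₀ (inv_ne_zero hq), zpow_natCast, inv_pow, div_eq_mul_inv, inv_inv, mul_comm]

variable {ι : Type*} [Fintype ι]

omit [BorelSpace F] [Fintype ι] in
/-- **THE VERTEX LAW AS A SHELL LETTER**: if `σ` is finite on compacts and `σ.real((𝔭^{n+1})^ι) = c·σ.real((𝔭^n)^ι)` for all `n` (`c ≥ 0`; (an-1)'s
`exists_nullConeMeasure` clause with `c = q^{−card ι}·q²`), then `σ((𝔭^{N₀+k})^ι) ≤ σ((𝔭^{N₀})^ι)·c^k` in `ℝ≥0∞` — the `hσ` letter of ★ p864503 §3.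
[cite: Weil1965, Chap. III n° 37 Prop. 6] -/
theorem measure_piPrimePowBall_le_of_vertexLaw (σ : Measure (ι → F)) [IsFiniteMeasureOnCompacts σ] {c : ℝ} (hc : 0 ≤ c)
    (hlaw : ∀ n : ℤ, σ.real (piPrimePowBall F ι (n + 1)) = c * σ.real (piPrimePowBall F ι n)) (N₀ : ℤ) (k : ℕ) :
    σ (piPrimePowBall F ι (N₀ + k)) ≤ ENNReal.ofReal (σ.real (piPrimePowBall F ι N₀)) * ENNReal.ofReal c ^ k := by
  have hfin : ∀ n : ℤ, σ (piPrimePowBall F ι n) ≠ ∞ := fun n => ((isCompact_piPrimePowBall n).measure_lt_top).ne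
  have hreal : ∀ k : ℕ, σ.real (piPrimePowBall F ι (N₀ + k)) = c ^ k * σ.real (piPrimePowBall F ι N₀) := by
    intro k
    induction k with
    | zero => simp
    | succ k ih =>
      rw [show N₀ + ((k + 1 : ℕ) : ℤ) = N₀ + k + 1 by push_cast; ring, hlaw, ih, pow_succ]
      ring
  rw [← ENNReal.ofReal_toReal (hfin (N₀ + k)), ← measureReal_def, hreal k, ENNReal.ofReal_mul (pow_nonneg hc k), ENNReal.ofReal_pow hc, mul_comm]

end Scaling

/-! ## §2 Slices of a Schwartz–Bruhat function of the two-block model, and the fibre bound at `s ≠ 0` -/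

section Fibre

variable {κ ι₂ ι₁ ι₁' ι : Type*} [Fintype κ] [Fintype ι₂] [Fintype ι₁] [Fintype ι₁'] [Fintype ι]
  (e : ι₁ ⊕ ι₁' ≃ ι) (eA : κ ⊕ ι₂ ≃ ι₁)

omit [MeasurableSpace F] [BorelSpace F] [Fintype κ] [Fintype ι₂] [Fintype ι] [Fintype ι₁] [Fintype ι₁'] in
/-- if `Θ` vanishes off the box `(𝔭^N)^ι`, its slice value `Θ(t ⊔ s)` vanishes unless `t ∈ (𝔭^N)^{ι₁}` and `s ∈ (𝔭^N)^{ι₁′}`. [cite: WeilBNT1967, Chap. VII §2] -/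
theorem slice_support {Θ : (ι → F) → ℂ} {N : ℤ} (hsupp : ∀ v, v ∉ piPrimePowBall F ι N → Θ v = 0) (t : ι₁ → F) (s : ι₁' → F)
    (h : Θ (glue e t s) ≠ 0) : t ∈ piPrimePowBall F ι₁ N ∧ s ∈ piPrimePowBall F ι₁' N := by
  by_contra hc
  refine h (hsupp _ fun hmem => hc ?_)
  rw [mem_piPrimePowBall_iff_resL_resR F e, resL_glue, resR_glue] at hmem
  exact hmem

omit [Fintype ι] [Fintype ι₁'] in
/-- **THE FIBRE BOUND AT `s ≠ 0`** (in `ℝ≥0∞`): with `A` adapted to `Z` (`hA`), the BOX-FIBRE letter `hres : A(0 ⊔ b) ∈ (𝔭^N)^{ι₁} → b ∈ (𝔭^N)^{ι₂}` (the fibre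
coordinate is recovered at SOME chart's slots — (an-3c-charts) K2Liu-p12 FLAG 3), `Θ` bounded by `M` and
supported in `(𝔭^N)^ι`, and the lower-bound letter `Z ζ ∈ (𝔭^{m−N})^{ι₁} → ζ ∈ (𝔭^{n₁})^κ`:
`∫⁻_b ‖|det A|·Θ(A(0⊔b) ⊔ s)‖ dμ^{ι₂} ≤ ofReal (M · c_κ⁻¹ · μ^{ι₁}((𝔭^N)^{ι₁}) · μ^κ((𝔭^{n₁})^κ))` (★ p864503 `fibreMass_box_le`).
[cite: Weil1965, Chap. III n° 37 Prop. 6] [cite: WeilBNT1967, Chap. VII §2, Cor. 1] -/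
theorem lintegral_frameDensity_le {ψ : AddChar F Circle} (hψ : ψ.IsContinuousNontrivial) {m : ℤ} (hm : ψ.HasConductorExp m)
    (Z : (κ → F) →ₗ[F] (ι₁ → F)) (A : (ι₁ → F) ≃ₗ[F] (ι₁ → F)) (hA : ∀ (t : ι₁ → F) (ζ : κ → F), A t ⬝ᵥ Z ζ = resL eA t ⬝ᵥ ζ)
    (hres : ∀ (b : ι₂ → F) (N' : ℤ), A (glue eA 0 b) ∈ piPrimePowBall F ι₁ N' → b ∈ piPrimePowBall F ι₂ N')
    {Θ : (ι → F) → ℂ} {M : ℝ} (hM0 : 0 ≤ M) (hM : ∀ v, ‖Θ v‖ ≤ M) {N : ℤ} (hsupp : ∀ v, v ∉ piPrimePowBall F ι N → Θ v = 0)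
    (s : ι₁' → F) (n₁ : ℤ) (hZ : ∀ ζ : κ → F, Z ζ ∈ piPrimePowBall F ι₁ (m - N) → ζ ∈ piPrimePowBall F κ n₁) :
    ∫⁻ b, ‖(((normAbs F (LinearMap.det (A : (ι₁ → F) →ₗ[F] (ι₁ → F))) : ℝ) : ℂ)) * Θ (glue e (A (glue eA 0 b)) s)‖ₑ ∂(Measure.pi fun _ : ι₂ => μ) ≤
      ENNReal.ofReal (M * (piSelfDualConst F κ (Measure.pi fun _ : κ => μ) m)⁻¹ *
        ((Measure.pi fun _ : ι₁ => μ).real (piPrimePowBall F ι₁ N) * (Measure.pi fun _ : κ => μ).real (piPrimePowBall F κ n₁))) := by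
  haveI : SecondCountableTopology F := secondCountableTopology_localField F
  set S : Set (ι₂ → F) := {b | A (glue eA 0 b) ∈ piPrimePowBall F ι₁ N} with hS
  set nd : ℝ := (normAbs F (LinearMap.det (A : (ι₁ → F) →ₗ[F] (ι₁ → F))) : ℝ) with hnd
  have hnd0 : 0 ≤ nd := NNReal.coe_nonneg _
  -- the fibre set is inside a box (box-fibre letter), hence of finite measure
  have hSsub : S ⊆ piPrimePowBall F ι₂ N := fun b hb => hres b N hb
  have hSfin : (Measure.pi fun _ : ι₂ => μ) S ≠ ∞ := ((measure_mono hSsub).trans_lt (measure_piPrimePowBall_lt_top _ N)).ne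
  have hSm : MeasurableSet S := (isClosed_preimage_frame_glue_piPrimePowBall eA A N).measurableSet
  -- pointwise: `‖|det A| Θ(A(0⊔b) ⊔ s)‖ ≤ nd·M·1_S(b)`
  have hpt : ∀ b, ‖(nd : ℂ) * Θ (glue e (A (glue eA 0 b)) s)‖ₑ ≤ S.indicator (fun _ => ENNReal.ofReal (nd * M)) b := by
    intro b
    by_cases hb : b ∈ S
    · rw [indicator_of_mem hb, ← ofReal_norm]
      refine ENNReal.ofReal_le_ofReal ?_
      rw [norm_mul, Complex.norm_real, Real.norm_of_nonneg hnd0]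
      exact mul_le_mul_of_nonneg_left (hM _) hnd0
    · have h0 : Θ (glue e (A (glue eA 0 b)) s) = 0 := by
        by_contra hne
        exact hb (slice_support e hsupp _ _ hne).1
      rw [indicator_of_notMem hb, h0, mul_zero, enorm_zero]
  -- the fibre mass bound of ★ p864503 §2, moved to `ℝ≥0∞`
  have hmass := fibreMass_box_le eA Z A μ hψ hm hA N n₁ hZ
  have hcκ : 0 < piSelfDualConst F κ (Measure.pi fun _ : κ => μ) m := piSelfDualConst_pos _
  have hmass' : nd * (Measure.pi fun _ : ι₂ => μ).real S ≤ (piSelfDualConst F κ (Measure.pi fun _ : κ => μ) m)⁻¹ *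
      ((Measure.pi fun _ : ι₁ => μ).real (piPrimePowBall F ι₁ N) * (Measure.pi fun _ : κ => μ).real (piPrimePowBall F κ n₁)) := by
    rw [le_inv_mul_iff₀ hcκ, ← mul_assoc]
    exact hmass
  calc ∫⁻ b, ‖(nd : ℂ) * Θ (glue e (A (glue eA 0 b)) s)‖ₑ ∂(Measure.pi fun _ : ι₂ => μ)
      ≤ ∫⁻ b, S.indicator (fun _ => ENNReal.ofReal (nd * M)) b ∂(Measure.pi fun _ : ι₂ => μ) := lintegral_mono hpt
    _ = ENNReal.ofReal (nd * M) * (Measure.pi fun _ : ι₂ => μ) S := lintegral_indicator_const hSm _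
    _ = ENNReal.ofReal (M * (nd * (Measure.pi fun _ : ι₂ => μ).real S)) := by
        rw [measureReal_def, ← ENNReal.ofReal_toReal hSfin, ← ENNReal.ofReal_mul (mul_nonneg hnd0 hM0), ENNReal.ofReal_toReal hSfin]
        congr 1
        ring
    _ ≤ ENNReal.ofReal (M * (piSelfDualConst F κ (Measure.pi fun _ : κ => μ) m)⁻¹ *
          ((Measure.pi fun _ : ι₁ => μ).real (piPrimePowBall F ι₁ N) * (Measure.pi fun _ : κ => μ).real (piPrimePowBall F κ n₁))) := by
        refine ENNReal.ofReal_le_ofReal ?_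
        rw [mul_assoc M]
        exact mul_le_mul_of_nonneg_left hmass' hM0

end Fibre

/-! ## §3 (I2): the density of the cone word is `L¹` on `σ ⊗ μ^{ι₂}` -/

section I2

variable {κ ι₂ ι₁ ι₁' ι : Type*} [Fintype κ] [Fintype ι₂] [Fintype ι₁] [Fintype ι₁'] [Fintype ι] [Nonempty ι₁']
  (e : ι₁ ⊕ ι₁' ≃ ι) (eA : κ ⊕ ι₂ ≃ ι₁)

/-- **(I2) — THE DENSITY OF THE CONE WORD IS `L¹` ON `σ ⊗ μ^{ι₂}`.**  `Θ ∈ 𝒮(F^ι)`; `σ` on the position block `F^{ι₁′}`, finite on compacts, s-finite, `σ{0} = 0`, with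
the VERTEX LAW `σ.real((𝔭^{n+1})^{ι₁′}) = (q^{card ι₁′})⁻¹·q²·σ.real((𝔭^n)^{ι₁′})` ((an-1) `exists_nullConeMeasure`); graph maps `Z_s` with the LOWER-BOUND letter
`∀ s ≠ 0, ∀ N ζ, Z_s ζ ∈ (𝔭^N)^{ι₁} → ζ ∈ (𝔭^{N − level s − c₀})^κ` ((an-3c-charts) (iii)); frames `A_s` adapted off the vertex with the box-fibre letter and
`(s,b) ↦ A_s(0 ⊔ b)`, `s ↦ |det A_s|` measurable ((an-3c-charts) (iv)); numerology `card κ + 2 < card ι₁′`.  THEN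
**`Integrable (fun (s,b) => |det A_s| · Θ(A_s(0 ⊔ b) ⊔ s)) (σ ⊗ μ^{ι₂})`** — ★ p864562's letter `hI2`.
Proof: fibre bound §2 on the shell `level s = N + k` is `≤ C·(q^{card κ})^k`; the vertex law gives `σ((𝔭^{N+k})^{ι₁′}) ≤ C′·(q^{2−card ι₁′})^k`; ★ p864503 §3–§4.
[cite: Weil1965, Chap. III n° 37 Prop. 6] [cite: KudlaRallis1994, §2 (2.10)–(2.12)] -/
theorem integrable_frameDensity {ψ : AddChar F Circle} (hψ : ψ.IsContinuousNontrivial) {m : ℤ} (hm : ψ.HasConductorExp m)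
    (σ : Measure (ι₁' → F)) [IsFiniteMeasureOnCompacts σ] [SFinite σ] (hσ0 : σ {0} = 0)
    (hlaw : ∀ n : ℤ, σ.real (piPrimePowBall F ι₁' (n + 1)) =
      (((residueFieldCard F : ℝ) ^ Fintype.card ι₁')⁻¹ * (residueFieldCard F : ℝ) ^ 2) * σ.real (piPrimePowBall F ι₁' n))
    (Zm : (ι₁' → F) → ((κ → F) →ₗ[F] (ι₁ → F))) (c₀ : ℤ)
    (hZlow : ∀ s : ι₁' → F, s ≠ 0 → ∀ (N : ℤ) (ζ : κ → F), Zm s ζ ∈ piPrimePowBall F ι₁ N → ζ ∈ piPrimePowBall F κ (N - level s - c₀))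
    (A : (ι₁' → F) → ((ι₁ → F) ≃ₗ[F] (ι₁ → F)))
    (hA : ∀ s : ι₁' → F, s ≠ 0 → ∀ (t : ι₁ → F) (ζ : κ → F), A s t ⬝ᵥ Zm s ζ = resL eA t ⬝ᵥ ζ)
    (hres : ∀ (s : ι₁' → F) (b : ι₂ → F) (N' : ℤ), A s (glue eA 0 b) ∈ piPrimePowBall F ι₁ N' → b ∈ piPrimePowBall F ι₂ N')
    (hAm : Measurable fun p : (ι₁' → F) × (ι₂ → F) => A p.1 (glue eA 0 p.2))
    (hdetm : Measurable fun s : ι₁' → F => normAbs F (LinearMap.det (A s : (ι₁ → F) →ₗ[F] (ι₁ → F))))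
    (hnum : Fintype.card κ + 2 < Fintype.card ι₁') (Θ : SchwartzBruhat (ι → F)) :
    Integrable (fun p : (ι₁' → F) × (ι₂ → F) =>
      (((normAbs F (LinearMap.det (A p.1 : (ι₁ → F) →ₗ[F] (ι₁ → F))) : ℝ) : ℂ)) * (Θ : (ι → F) → ℂ) (glue e (A p.1 (glue eA 0 p.2)) p.1))
      (σ.prod (Measure.pi fun _ : ι₂ => μ)) := by
  haveI : T2Space F := (isLocalField F).toT2Space
  haveI : SecondCountableTopology F := secondCountableTopology_localField F
  -- data of `Θ`: a bound and a support box
  obtain ⟨M, hM⟩ := Θ.2.1.continuous.bounded_above_of_compact_support Θ.2.2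
  have hM0 : 0 ≤ M := (norm_nonneg _).trans (hM 0)
  obtain ⟨N, hN⟩ := exists_eq_zero_of_notMem_piPrimePowBall Θ.2
  -- constants
  have hq1 : (1 : ℝ) < (residueFieldCard F : ℝ) := by exact_mod_cast one_lt_residueFieldCard F
  have hq0 : (0 : ℝ) < (residueFieldCard F : ℝ) := zero_lt_one.trans hq1
  set cκ : ℝ := piSelfDualConst F κ (Measure.pi fun _ : κ => μ) m with hcκ
  set K₀ : ℝ := M * cκ⁻¹ * ((Measure.pi fun _ : ι₁ => μ).real (piPrimePowBall F ι₁ N) *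
    (Measure.pi fun _ : κ => μ).real (piPrimePowBall F κ (m - N - N - c₀))) with hK₀
  have hK₀0 : 0 ≤ K₀ := by
    have : 0 < cκ := piSelfDualConst_pos _
    positivity
  -- the fibre weight: `⊤` at the vertex, `0` off the support box, the §2 bound on its shells
  set f : (ι₁' → F) → ℝ≥0∞ := fun s => ENNReal.ofReal (M * cκ⁻¹ * ((Measure.pi fun _ : ι₁ => μ).real (piPrimePowBall F ι₁ N) *
    (Measure.pi fun _ : κ => μ).real (piPrimePowBall F κ (m - N - level s - c₀)))) with hf
  set W : (ι₁' → F) → ℝ≥0∞ := fun s => ({0} : Set (ι₁' → F)).indicator (fun _ => ∞) s + (piPrimePowBall F ι₁' N).indicator f s with hW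
  refine integrable_prod_of_lintegral_fibre_le σ (Measure.pi fun _ : ι₂ => μ) ?_ W (fun s => ?_) ?_
  · -- measurability
    refine (Measurable.aestronglyMeasurable ?_)
    refine ((Complex.measurable_ofReal.comp (NNReal.continuous_coe.measurable.comp (hdetm.comp measurable_fst))).mul ?_)
    exact Θ.2.1.continuous.measurable.comp ((continuous_glue e).measurable.comp (hAm.prodMk measurable_fst))
  · -- the fibre bound `∫⁻_b ‖…‖ ≤ W s`
    by_cases hs0 : s = 0
    · subst hs0
      rw [hW]
      simp only [indicator_of_mem (mem_singleton _), top_add]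
      exact le_top
    by_cases hsN : s ∈ piPrimePowBall F ι₁' N
    · have hle := lintegral_frameDensity_le μ e eA hψ hm (Zm s) (A s) (hA s hs0) (hres s) hM0 hM hN s (m - N - level s - c₀)
        (fun ζ hζ => hZlow s hs0 (m - N) ζ hζ)
      refine hle.trans ?_
      rw [hW]
      simp only [indicator_of_notMem (show s ∉ ({0} : Set (ι₁' → F)) from hs0), indicator_of_mem hsN, zero_add, hf]
      exact le_rfl
    · -- off the support box the density vanishes identically
      have h0 : ∀ b, (((normAbs F (LinearMap.det (A s : (ι₁ → F) →ₗ[F] (ι₁ → F))) : ℝ) : ℂ)) * (Θ : (ι → F) → ℂ) (glue e (A s (glue eA 0 b)) s) = 0 := by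
        intro b
        have : (Θ : (ι → F) → ℂ) (glue e (A s (glue eA 0 b)) s) = 0 := by
          by_contra hne
          exact hsN (slice_support e hN _ _ hne).2
        rw [this, mul_zero]
      simp only [h0, enorm_zero, lintegral_zero]
      exact bot_le
  · -- `∫⁻ W dσ < ∞`: the vertex is null, the shells sum
    have hWm : Measurable fun s => ({0} : Set (ι₁' → F)).indicator (fun _ => (∞ : ℝ≥0∞)) s :=
      measurable_const.indicator (measurableSet_singleton 0)
    rw [hW, lintegral_add_left hWm, lintegral_indicator_const (measurableSet_singleton 0), hσ0, mul_zero, zero_add,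
      lintegral_indicator (Literature.NumberTheory.Weil1965.SplitPlace.measurableSet_piPrimePowBall' N)]
    -- shell bound for `f`: on the shell of level `N + k`, `f s = ofReal K₀ * (q^{card κ})^k`
    refine setLIntegral_lt_top_of_shell_bound σ hσ0 N f (Cf := ENNReal.ofReal K₀) (r := ENNReal.ofReal ((residueFieldCard F : ℝ) ^ Fintype.card κ))
      (Cσ := ENNReal.ofReal (σ.real (piPrimePowBall F ι₁' N)))
      (ρ := ENNReal.ofReal ((((residueFieldCard F : ℝ) ^ Fintype.card ι₁')⁻¹ * (residueFieldCard F : ℝ) ^ 2)))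
      ENNReal.ofReal_ne_top ENNReal.ofReal_ne_top ?_ (fun k s hs hs' => ?_) (fun k => ?_)
    · -- `r·ρ = q^{card κ + 2 − card ι₁′} < 1`
      rw [← ENNReal.ofReal_mul (pow_nonneg hq0.le _), ← ENNReal.ofReal_one]
      refine (ENNReal.ofReal_lt_ofReal_iff_of_nonneg (by positivity)).2 ?_
      rw [← mul_assoc, mul_comm ((residueFieldCard F : ℝ) ^ Fintype.card κ), mul_assoc, inv_mul_lt_iff₀ (pow_pos hq0 _), mul_one, ← pow_add]
      exact pow_lt_pow_right₀ hq1 (by omega)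
    · -- on the shell `(𝔭^{N+k}) ∖ (𝔭^{N+k+1})`: `level s = N + k`
      have hlev : level s = N + k := level_eq_of_mem_shell ⟨hs, hs'⟩
      rw [hf]
      dsimp only
      rw [hlev, show m - N - (N + (k : ℤ)) - c₀ = (m - N - N - c₀) - k by ring, measureReal_pi_piPrimePowBall_sub_natCast μ,
        ← ENNReal.ofReal_pow (pow_nonneg hq0.le _), ← ENNReal.ofReal_mul hK₀0]
      refine ENNReal.ofReal_le_ofReal (le_of_eq ?_)
      rw [hK₀]
      ring
    · exact measure_piPrimePowBall_le_of_vertexLaw σ (by positivity) hlaw N k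

end I2

end Summit.HodgeConjecture.HodgeConjecture.Cruxes.HLiu418.K2LiuConeWordIntegrability

end
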